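/-
COR-CM (cell pub-hodgecm2 = stage 2 of the Hodge ladder), binder seat b14 gen 15 (prover-pub-hodgecm2-b14-g15-0,
2026-08-21).  Count-neutral KERNEL INPUT for the coordinator's Hodge VACUITY/MODEL audit (HOME/INBOX.md l.2004; audited
item: the E term `Summit.HodgeConjecture.CorCM.hc_cm_of_PerLFace`, p238778), HYPOTHESIS SIDE (lane E-HYP-NV of
HOME/LIT-CLAIMS.md; disjoint from the carrier/conclusion lane `Assembly/CarrierNonVacuity.lean` (p1, VAC-W) and the record
lane `Literature/…/AbelianVarietyHodgeFullnessNonVacuity.lean` (b02, B02-NV), RULING VAC-LANES l.2068).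
Theorems only: no definition, no named fact, no instance.
-/
import Summits.HodgeConjecture.CorCM.Model.ModelAxiomsHolds
import Summits.HodgeConjecture.CorCM.Model.DimZeroDomination
import Summits.HodgeConjecture.CorCM.Geometry.NonVacuity
import Summits.HodgeConjecture.CorCM.CM.Lemmas
import Literature.AlgebraicGeometry.Motives.AbelianVarietyCohomologyExteriorH1
import Literature.AlgebraicGeometry.HodgeTheory.ClassesSupportedOnComplexification
import Mathlib.NumberTheory.Cyclotomic.Basic
import Mathlib.NumberTheory.NumberField.CMField
import Mathlib.RingTheory.Polynomial.Cyclotomic.Roots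
import Mathlib.RingTheory.Flat.Basic
import HarnessLib

/-!
# The period functional of the Picard–CM model universe is not identically zero

The stage-2 E term `hc_cm_of_PerLFace : HC_CM_of_PerLFace` (`CorCM/Assembly/ModelChain.lean`) reads
`∀ hHD hI h₁ h₃, (Model.picardCMUniverse hHD hI h₁ h₃).PerLFace → DeligneMilne1982_Thm_6_20_full → HC_CM`.
Its displayed leaves `hHD`, `hI`, `h₃`, `hR` are tree theorems (`…_holds`), `h₁` is reduced to one analytic record; the
ONE open leaf is the HYPOTHESIS `U₀.PerLFace = U₀.PeriodThmF` (`CorCM/Geometry/Statements.lean`): for every Galois CM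
field `F` with `6 ≤ [F:ℚ]`, every rank-four face `f`, every admissible `ι₁` and every hermitian 3-space `V`, SOME
level `Γ`, morphisms `Fᵢ : P_Γ → A_{(F, f.psi i)}` and `ι₁`-eigen holomorphic one-forms `αᵢ` have
`U₀.period P_Γ (Fᵢ^* αᵢ)ᵢ ≠ 0`, where (`CorCM/Geometry/Universe.lean`)
`U.period X ω = U.trC X 4 ((ω₀ ∪ ω₁) ∪ (conj ω₂ ∪ conj ω₃))`.

A universally quantified implication is vacuous if its hypothesis is refutable.  The cheapest conceivable refutation of
`U.PeriodThmF` is a DEGENERATE period functional: b14 gen 4 showed (`Geometry/PeriodFreeShadow.lean`: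
`modelAxioms_of_tr_zero`, `not_periodThmF_of_tr`, `not_forall_modelAxioms_imp_periodThmF`) that the 28 structural facts
`U.ModelAxioms` do NOT exclude a universe whose trace — hence every period — is identically zero, and that on such a
universe `PeriodThmF` is FALSE, its binder prefix being inhabited (`Geometry/NonVacuity.lean`,
`periodThmF_binders_inhabited`).  This file shows, hypothesis-free and for ALL values of the displayed data, that THE
model universe of the E term is not of that kind, and that the other primitives entering `PeriodThmF` are non-degenerate:

* `Model.universeOf_period_ne_zero` / `Model.picardCMUniverse_period_ne_zero` — there are a variety `X` of
  `U₀ := Model.universeOf hHD hI hU h₃` and classes `ω : Fin 4 → ℂ ⊗_ℚ H¹(X(ℂ); ℚ)` with `U₀.period X ω ≠ 0`.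
  Witness: `X` = the realised CM abelian surface `U₀.cmAV ℚ(ζ₅) Φ` (any CM type `Φ`): `H⁴(A(ℂ); ℂ)` is spanned by
  four-fold cup products of degree-one classes (`Motives.abelianVarietyCohomologyExteriorH1_holds`, Lange–Birkenhake
  Ex. 1.1.6 (7)) and `H⁴(A(ℂ); ℚ)` is a line (`finrank_rat_top`), on which the tree's light trace `BettiUniverse.tr` is
  the (injective) coordinate functional (`Model.tr_top_injective`), as is its complexification (`ℂ` is flat over `ℚ`).
* `Model.trC_injective_of_eq` — the complexified trace of a smooth projective variety is injective in the top degree.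
* `Model.universeOf_alphaLine_psi_ne_bot` — for every face `f` and ADMISSIBLE `ι₁` the four lines of `ι₁`-eigen
  holomorphic one-forms `U₀.alphaLine F (f.psi i) ι₁` entering `PeriodNV` are non-zero (`Fact_alphaLine`,
  `Fact_eigenLine` of `Model.modelAxioms_holds`; `Face.admissible_mem_psi`): the `αᵢ` range over non-trivial lines.
* (already in the tree, b14 gen 4, `Geometry/NonVacuity.lean`: `periodThmF_binders_inhabited`) the binder prefix of
  `U₀.PeriodThmF` is inhabited with a level (`F = ℚ(ζ₇)`), so `U₀.PeriodThmF` is not true for want of instances either,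
  and on the zero-trace shadows it is false (`Geometry/PeriodFreeShadow.lean`, `not_periodThmF_of_tr`).

What this does NOT (and no kernel theorem can) show: that `U₀.PerLFace` is irrefutable.  With the degenerate readings
excluded — binder prefix inhabited, period functional / top traces / eigen-lines non-degenerate on the model of record —
what `U₀.PerLFace` asserts is the period theorem F of the 2001 programme on compact Picard modular surfaces (stage 1b
of the Hodge ladder), a genuinely open analytic statement and the E term's displayed leaf by design.
-/

noncomputable section

open scoped TensorProduct
open CategoryTheory Module
open Literature.AlgebraicTopology.SingularHomology (singularCohomology cupProduct cupPowOne cupPowOne_succ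
  cupPowOne_one cupProduct_assoc)
open Literature.AlgebraicGeometry.Motives (AbelianVariety CMType ComplexPoints IsSmoothProjective SchemeOver
  bettiCohomology abelianVarietyCohomologyExteriorH1_holds ofRatClassBaseChange)
open Literature.AlgebraicGeometry.Motives.HodgeStructure (conj conj_conj)
open Literature.AlgebraicGeometry.HodgeTheory
open Literature.NumberTheory.Automorphic.PicardCM
open NumberField

namespace Summit.HodgeConjecture.CorCM.Model

/-! ### §1 Space level: a non-zero four-fold cup product of degree-one classes -/

section SpaceLevel

variable {Y : Type} [TopologicalSpace Y]

/-- `(v₀ ⌣ v₁) ⌣ (v₂ ⌣ v₃) = v₀ ⌣ (v₁ ⌣ (v₂ ⌣ v₃)) = cupPowOne 4 v` — the shape of `Universe.quadC` versus the tree's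
iterated product of degree-one classes (associativity and unit of the cup product).
[cite: HatcherAT2002, §3.2 Prop. 3.10] -/
theorem cupProduct_two_two_eq_cupPowOne (v : Fin 4 → singularCohomology ℂ ℂ Y 1) :
    cupProduct (rfl : 2 + 2 = 4) (cupProduct (rfl : 1 + 1 = 2) (v 0) (v 1))
        (cupProduct (rfl : 1 + 1 = 2) (v 2) (v 3)) = cupPowOne ℂ Y 4 v := by
  rw [cupProduct_assoc (rfl : 1 + 1 = 2) (rfl : 1 + 2 = 3) (rfl : 2 + 2 = 4) (rfl : 1 + 3 = 4) (v 0) (v 1)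
      (cupProduct (rfl : 1 + 1 = 2) (v 2) (v 3))]
  rw [cupPowOne_succ, cupPowOne_succ, cupPowOne_succ, cupPowOne_one]
  rfl

/-- **On a complex abelian variety with `H⁴(A(ℂ); ℂ) ≠ 0` some product `(v₀ ⌣ v₁) ⌣ (v₂ ⌣ v₃)` of degree-one
classes is non-zero**: `H⁴(A(ℂ); ℂ)` is spanned by the four-fold products of degree-one classes
(`Motives.abelianVarietyCohomologyExteriorH1_holds`, `H•(A(ℂ); ℂ) = ⋀• H¹`).
[cite: LangeBirkenhake1992, Lemma 1.1.17 and Exercise 1.1.6 (7)] -/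
theorem exists_cupProduct_two_two_ne_zero (A : AbelianVariety ℂ)
    (h4 : 0 < Module.finrank ℂ (singularCohomology ℂ ℂ (ComplexPoints A.X) 4)) :
    ∃ v₀ v₁ v₂ v₃ : singularCohomology ℂ ℂ (ComplexPoints A.X) 1,
      cupProduct (rfl : 2 + 2 = 4) (cupProduct (rfl : 1 + 1 = 2) v₀ v₁) (cupProduct (rfl : 1 + 1 = 2) v₂ v₃) ≠ 0 := by
  haveI := abelianVarietyCohomologyExteriorH1_holds.finite A 4
  obtain ⟨z, hz⟩ := (Module.finrank_pos_iff_exists_ne_zero (R := ℂ)).1 h4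
  by_contra H
  simp only [not_exists, not_not] at H
  have hspan := abelianVarietyCohomologyExteriorH1_holds.span_range_cupPowOne A 4
  have hle : (⊤ : Submodule ℂ (singularCohomology ℂ ℂ (ComplexPoints A.X) 4)) ≤ ⊥ := by
    rw [← hspan, Submodule.span_le]
    rintro _ ⟨v, rfl⟩
    rw [SetLike.mem_coe, Submodule.mem_bot, ← cupProduct_two_two_eq_cupPowOne v]
    exact H (v 0) (v 1) (v 2) (v 3)
  exact hz ((Submodule.mem_bot ℂ).1 (hle Submodule.mem_top))

end SpaceLevel

/-! ### §2 Scheme level: top-degree ranks and the injectivity of the complexified trace -/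

section SchemeLevel

variable {n : ℕ} {X : SchemeOver ℂ}

/-- `dim_ℚ Hᵏ(X(ℂ); ℚ) = 1` in the top degree `k = 2n` of a smooth projective `n`-fold (the tree's `finrank_rat_top`,
with the degree as a separate variable so that consumers need no dependent rewriting).
[cite: VoisinHodgeI2002, §5.3.2 Thm. 5.30] -/
theorem finrank_rat_eq_one_of_eq (hX : IsSmoothProjective n X) {k : ℕ} (hk : k = 2 * n) :
    Module.finrank ℚ (bettiCohomology X k) = 1 := by
  subst hk
  exact finrank_rat_top hX

/-- `dim_ℂ Hᵏ(X(ℂ); ℂ) = 1` in the top degree (`β : ℂ ⊗_ℚ Hᵏ(X(ℂ); ℚ) ≃ Hᵏ(X(ℂ); ℂ)`).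
[cite: VoisinHodgeI2002, §5.3.2 Thm. 5.30 and §7.1.1] -/
theorem finrank_complex_eq_one_of_eq (hX : IsSmoothProjective n X) {k : ℕ} (hk : k = 2 * n) :
    Module.finrank ℂ (singularCohomology ℂ ℂ (ComplexPoints X) k) = 1 := by
  rw [← (ofRatClassBaseChangeEquiv hX k).finrank_eq, Module.finrank_baseChange, finrank_rat_eq_one_of_eq hX hk]

/-- **The complexified trace `trC = rid ∘ (tr ⊗ ℂ)` is injective in the top degree**: `tr` is the (injective,
`Model.tr_top_injective`) coordinate functional of the line `H^{2n}(X(ℂ); ℚ)`, and `ℂ` is flat over `ℚ`.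
[cite: VoisinHodgeI2002, §5.3.2 Thm. 5.30] -/
theorem trC_injective_of_eq (hX : IsSmoothProjective n X) {k : ℕ} (hk : k = 2 * n) :
    Function.Injective (BettiUniverse.trC hX k) := by
  subst hk
  have hinj : Function.Injective ((BettiUniverse.tr hX (2 * n)).baseChange ℂ) := by
    rw [LinearMap.baseChange_eq_ltensor]
    exact Module.Flat.lTensor_preserves_injective_linearMap _ (tr_top_injective hX)
  intro x y hxy
  exact hinj ((TensorProduct.AlgebraTensorModule.rid ℚ ℂ ℂ).injective hxy)

end SchemeLevel

/-! ### §3 The auxiliary CM field `ℚ(ζ₅)` (a CM abelian SURFACE: `[ℚ(ζ₅):ℚ]/2 = 2`) -/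

/-- `ℚ(ζ₅)` is a CM field (Mathlib: nontrivial cyclotomic extensions of `ℚ` are CM). [folklore] -/
private theorem isCMField_cyclotomic_five : IsCMField (CyclotomicField 5 ℚ) :=
  @IsCyclotomicExtension.Rat.isCMField (CyclotomicField 5 ℚ) _ _ {5} ⟨5, rfl, by norm_num⟩
    (CyclotomicField.isCyclotomicExtension 5 ℚ)

/-- `[ℚ(ζ₅):ℚ] = 4`. [folklore] -/
private theorem finrank_cyclotomic_five : Module.finrank ℚ (CyclotomicField 5 ℚ) = 4 := by
  have h := @IsCyclotomicExtension.finrank 5 _ ℚ (CyclotomicField 5 ℚ) _ _ _ _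
    (CyclotomicField.isCyclotomicExtension 5 ℚ) (Polynomial.cyclotomic.irreducible_rat (n := 5) (by norm_num))
  rw [h]; decide

/-! ### §4 The model universe: period, traces, eigen-lines -/

section ModelUniverse

/-- **The complexified trace of the model universe is injective in the top degree** of every variety
(`Var.isSmoothProjective`, `trC_injective_of_eq`). [cite: VoisinHodgeI2002, §5.3.2 Thm. 5.30] -/
theorem universeOf_trC_injective (hHD : exists_isReal_hodgeModel) (hI : hodgePQ_independent_of_hodgeModel)
    (hU : BallQuotientUniformisedDatum) (h₃ : CMAbelianVarietyRealised)
    (X : (universeOf hHD hI hU h₃).Var) {k : ℕ}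
    (hk : k = 2 * (universeOf hHD hI hU h₃).dim X) :
    Function.Injective ((universeOf hHD hI hU h₃).trC X k) :=
  trC_injective_of_eq (Var.isSmoothProjective hU h₃ X) hk

/-- **The period functional of the Picard–CM model universe is not identically zero** (all parameter values): on the
realised CM abelian surface `X = U₀.cmAV ℚ(ζ₅) Φ` there are classes `ω₀, …, ω₃ ∈ ℂ ⊗_ℚ H¹(X(ℂ); ℚ)` with
`U₀.period X ω = U₀.trC X 4 ((ω₀ ∪ ω₁) ∪ (conj ω₂ ∪ conj ω₃)) ≠ 0`.  Hence the refutation of `PeriodThmF` available on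
the zero-trace shadow universes of `Geometry/PeriodFreeShadow.lean` (which satisfy all 28 `ModelAxioms`) is NOT
available on the model of record. [cite: LangeBirkenhake1992, Lemma 1.1.17 and Exercise 1.1.6 (7)–(8)]
[cite: VoisinHodgeI2002, §5.3.2 Thm. 5.30] -/
theorem universeOf_period_ne_zero (hHD : exists_isReal_hodgeModel) (hI : hodgePQ_independent_of_hodgeModel)
    (hU : BallQuotientUniformisedDatum) (h₃ : CMAbelianVarietyRealised) :
    ∃ (X : (universeOf hHD hI hU h₃).Var) (ω : Fin 4 → (universeOf hHD hI hU h₃).CohC X 1),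
      (universeOf hHD hI hU h₃).period X ω ≠ 0 := by
  classical
  haveI : IsCMField (CyclotomicField 5 ℚ) := isCMField_cyclotomic_five
  let K : CMField := ⟨CyclotomicField 5 ℚ⟩
  obtain ⟨Φ⟩ := nonempty_cmType K
  -- the code, its realisation, and the variety of the universe
  let c : CMCode := cmCode K Φ
  let R : CMRealisation c := cmRealisation h₃ c
  let X : (universeOf hHD hI hU h₃).Var := Var.cm c
  -- `dim X = 2` (row `Fact_cmAV` of the model: `dim (cmAV K Φ) = [K:ℚ]/2`)
  have hdim : Var.dim (Var.cm c) = 2 := by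
    have h := ((modelAxioms_holds hHD hI hU h₃).cmAV K Φ).2.2
    change Var.dim (Var.cm c) = Module.finrank ℚ (CyclotomicField 5 ℚ) / 2 at h
    rw [h, finrank_cyclotomic_five]
  -- the realising scheme is smooth projective of dimension `dim X`; `H⁴(A(ℂ); ℂ)` is a line
  have hX : IsSmoothProjective (Var.dim (Var.cm c)) R.AV.X := Var.isSmoothProjective hU h₃ (Var.cm c)
  have h4 : (4 : ℕ) = 2 * Var.dim (Var.cm c) := by rw [hdim]
  have hpos : 0 < Module.finrank ℂ (singularCohomology ℂ ℂ (ComplexPoints R.AV.X) 4) := by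
    rw [finrank_complex_eq_one_of_eq hX h4]; exact one_pos
  -- a non-zero four-fold product of degree-one classes, lifted to `ℂ ⊗_ℚ H¹(X(ℂ); ℚ)`
  obtain ⟨v₀, v₁, v₂, v₃, hv⟩ := exists_cupProduct_two_two_ne_zero R.AV hpos
  let β := ofRatClassBaseChangeEquiv hX 1
  let a := β.symm v₀
  let b := β.symm v₁
  let c' := β.symm v₂
  let d := β.symm v₃
  have ha : ofRatClassBaseChange (ComplexPoints R.AV.X) 1 a = v₀ := β.apply_symm_apply v₀
  have hb : ofRatClassBaseChange (ComplexPoints R.AV.X) 1 b = v₁ := β.apply_symm_apply v₁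
  have hc : ofRatClassBaseChange (ComplexPoints R.AV.X) 1 c' = v₂ := β.apply_symm_apply v₂
  have hd : ofRatClassBaseChange (ComplexPoints R.AV.X) 1 d = v₃ := β.apply_symm_apply v₃
  refine ⟨X, ![a, b, conj c', conj d], ?_⟩
  -- unfold the period: `trC X 4 ((a ∪ b) ∪ (conj conj c' ∪ conj conj d)) = trC X 4 (quadC X a b c' d)`
  have hperiod : (universeOf hHD hI hU h₃).period X ![a, b, conj c', conj d] =
      (universeOf hHD hI hU h₃).trC X 4 ((universeOf hHD hI hU h₃).quadC X a b c' d) := by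
    simp only [Universe.period, Matrix.cons_val_zero, Matrix.cons_val_one, Matrix.cons_val, conj_conj]
  rw [hperiod]
  -- `β₄ (quadC X a b c' d) = (v₀ ⌣ v₁) ⌣ (v₂ ⌣ v₃) ≠ 0`
  have hq : ofRatClassBaseChange (ComplexPoints R.AV.X) 4 ((universeOf hHD hI hU h₃).quadC X a b c' d) =
      cupProduct (rfl : 2 + 2 = 4) (cupProduct (rfl : 1 + 1 = 2) v₀ v₁) (cupProduct (rfl : 1 + 1 = 2) v₂ v₃) := by
    have e1 : ofRatClassBaseChange (ComplexPoints R.AV.X) 4 ((universeOf hHD hI hU h₃).quadC X a b c' d) =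
        cupProduct (rfl : 2 + 2 = 4)
          (ofRatClassBaseChange (ComplexPoints R.AV.X) 2 ((universeOf hHD hI hU h₃).cup2C X 1 a b))
          (ofRatClassBaseChange (ComplexPoints R.AV.X) 2 ((universeOf hHD hI hU h₃).cup2C X 1 c' d)) :=
      BettiUniverse.ofRatClassBaseChange_cup2 R.AV.X 2 _ _
    have e2 : ofRatClassBaseChange (ComplexPoints R.AV.X) 2 ((universeOf hHD hI hU h₃).cup2C X 1 a b) =
        cupProduct (rfl : 1 + 1 = 2) (ofRatClassBaseChange (ComplexPoints R.AV.X) 1 a)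
          (ofRatClassBaseChange (ComplexPoints R.AV.X) 1 b) :=
      BettiUniverse.ofRatClassBaseChange_cup2 R.AV.X 1 a b
    have e3 : ofRatClassBaseChange (ComplexPoints R.AV.X) 2 ((universeOf hHD hI hU h₃).cup2C X 1 c' d) =
        cupProduct (rfl : 1 + 1 = 2) (ofRatClassBaseChange (ComplexPoints R.AV.X) 1 c')
          (ofRatClassBaseChange (ComplexPoints R.AV.X) 1 d) :=
      BettiUniverse.ofRatClassBaseChange_cup2 R.AV.X 1 c' d
    rw [e1, e2, e3, ha, hb, hc, hd]
  intro h0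
  -- `trC X 4` is injective, so `quadC X a b c' d = 0`, contradicting `hq` and `hv`
  have hquad : (universeOf hHD hI hU h₃).quadC X a b c' d = 0 :=
    universeOf_trC_injective hHD hI hU h₃ X h4 (by rw [h0, map_zero])
  apply hv
  rw [← hq, hquad]
  exact map_zero _

/-- **The same for the model universe of record** `Model.picardCMUniverse hHD hI h₁ h₃`
(`= universeOf hHD hI (ballQuotientUniformisedDatum_of h₁) h₃` by `rfl`), the universe of the E term
`hc_cm_of_PerLFace`. [cite: LangeBirkenhake1992, Exercise 1.1.6 (7)–(8)] -/
theorem picardCMUniverse_period_ne_zero (hHD : exists_isReal_hodgeModel) (hI : hodgePQ_independent_of_hodgeModel)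
    (h₁ : BallQuotientUniformised) (h₃ : CMAbelianVarietyRealised) :
    ∃ (X : (picardCMUniverse hHD hI h₁ h₃).Var) (ω : Fin 4 → (picardCMUniverse hHD hI h₁ h₃).CohC X 1),
      (picardCMUniverse hHD hI h₁ h₃).period X ω ≠ 0 :=
  universeOf_period_ne_zero hHD hI (ballQuotientUniformisedDatum_of h₁) h₃

/-- **The eigen-one-form lines entering `PeriodNV` are non-zero**: for every CM field `F`, face `f` and ADMISSIBLE
embedding `ι₁`, each of the four lines `U₀.alphaLine F (f.psi i) ι₁` of `ι₁`-eigen holomorphic one-forms on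
`A_{(F, Ψᵢ)}` is non-trivial — `ι₁ ∈ Ψᵢ` (`Face.admissible_mem_psi`), so the holomorphic eigen-line is the whole
eigen-line (`Fact_alphaLine`), which is one-dimensional (`Fact_eigenLine`); both facts from `Model.modelAxioms_holds`.
[cite: Shimura1998, §5.2 pp. 38–39 and §3.2] -/
theorem universeOf_alphaLine_psi_ne_bot (hHD : exists_isReal_hodgeModel) (hI : hodgePQ_independent_of_hodgeModel)
    (hU : BallQuotientUniformisedDatum) (h₃ : CMAbelianVarietyRealised)
    (F : CMField) (f : Face F) (ι₁ : F →+* ℂ) (hι : f.Admissible ι₁)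
    (i : Fin 4) : (universeOf hHD hI hU h₃).alphaLine F (f.psi i) ι₁ ≠ ⊥ := by
  have M := modelAxioms_holds hHD hI hU h₃
  have hmem : ι₁ ∈ (f.psi i).1 := admissible_mem_psi f ι₁ hι i
  rw [(M.alphaLine F (f.psi i) ι₁).1 hmem]
  intro hbot
  have h1 := M.eigenLine F (f.psi i) ι₁
  rw [hbot, finrank_bot] at h1
  exact zero_ne_one h1

end ModelUniverse

end Summit.HodgeConjecture.CorCM.Model

end
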